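import Summits.KontsevichZagierPeriods.KontsevichZagierPeriods.Theorems.TerasomaMultiplicationBetaCancellationScaledJacobian
import Summits.KontsevichZagierPeriods.KontsevichZagierPeriods.Theorems.TerasomaMultiplicationBetaCancellationTwoPieceFibreSubstitution

/-!
# `BetaCancellation` (stmt-KontsevichZagierPeriods-13633), line `dirichlet-companion-to-pi` — stub `stub_twoPieceFibreSubstitution_anyFractions` (seat c15): TWO-PIECE FIBRE-FORM SUBSTITUTIONS DESCEND UNCONDITIONALLY

**Seat c14's two-piece theorem without the algebraicity hypothesis.** `stub_twoPieceFibreSubstitution`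
(module `…TwoPieceFibreSubstitution`): for a catalyst `p = [K, k]`, a splitting `K = K₁ ⊔ K₂` into
`ℚ`-semialgebraic pieces of non-zero mass with ALGEBRAIC mass fractions `cᵢ = (∫_{Kᵢ} k)/(∫_K k)`, and
ONE change of variables `Φ : p ⊗ r → p ⊗ r'` of fibre form `ψᵢ` on `Kᵢ × σ` with disjoint images
`ψ₁ σ`, `ψ₂ σ`, one has `r ∼ r'`. Here the fractions are NOT assumed algebraic
(`stub_twoPieceFibreSubstitution_anyFractions`, hypothesis `p.value ≠ 0` instead):

* each piece yields the scaled a.e. identity `cᵢ · f = (f' ∘ ψᵢ)|det ψᵢ'|` on `σ` (`twoPiece_pieceAE`: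
  the restrictions `p|Kᵢ ⊗ r → p ⊗ r'|ψᵢσ` form a catalyst exchange, measure core
  `stub_fibreSubstitutionTwoCatalystsAE` — the bookkeeping of seat c14's `twoPiece_pieceDescent`);
* if the base `r` is not null, the fractions ARE algebraic (`isAlgebraic_of_ae_scaledJacobian`, module
  `…ScaledJacobian`: `cᵢ` is the a.e. value of a `ℚ`-semialgebraic function on a non-null set) and
  c14's theorem applies verbatim;
* if `r` is null, so is `r'` (`volume_image_sep_ne_zero_eq_zero`: `{f' ≠ 0} ⊆ ψ₁ A₁ ∪ ψ₂ A₂` with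
  `|det ψᵢ'| = 0` a.e. on `Aᵢ`, area inequality), and both are relations
  (`of_mem_relations_of_volume_sep_ne_zero_eq_zero`).

So the "transcendental catalyst fraction" version of this certificate shape (a disc segment cut by a
chord, an incomplete Beta value — crux notes c14 K5 (iv), K7, K8 (vi), named there as the first layer
of the one-move residual) does not exist: transcendental constants cannot hide in ONE substitution
between `ℚ`-semialgebraic data. No definitions; sorry-free; axioms ⊆ {propext, Classical.choice,
Quot.sound}.

References: M. Kontsevich, D. Zagier, *Periods* (2001), §1.2 rules (1), (2); J. Bochnak, M. Coste,
M.-F. Roy, *Real Algebraic Geometry* (1998), §2.8.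
-/

noncomputable section

-- `Summit.KontsevichZagierPeriods.KontsevichZagierPeriods.…` is the tree's mandated layout (single-conjunct summit).
set_option linter.dupNamespace false

namespace Summit.KontsevichZagierPeriods.KontsevichZagierPeriods.BetaCancellationLine

open MeasureTheory Set
open Literature.ModelTheory.ExponentialFields (IsSemialgebraic)
open Literature.NumberTheory.Transcendental
open Literature.NumberTheory.Transcendental.KZ

/-! ### One piece: the scaled a.e. Jacobian identity -/

/-- **Piece a.e. identity.** In the situation of the two-piece theorem, fix ONE piece `K₁ ⊆ K`
(`ℚ`-semialgebraic, mass `κ₁ = ∫_{K₁} k ≠ 0`) over which `Φ` is of fibre form `ψ₁`, assume that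
points of `q.domain` with head OUTSIDE `K₁` are not sent by `tail ∘ Φ` into `ψ₁ σ`, and let `r'₁`
have domain `ψ₁ σ` and the integrand of `r'`. Then for every real `c₁` with `c₁ · p.value = κ₁` the
scaled rule-(2) identity `c₁ · f = (f' ∘ ψ₁)|det ψ₁'|` holds a.e. on `σ`: the restrictions
`p|K₁ ⊗ r → p ⊗ r'₁` of the one-move data form a catalyst exchange, to which the measure core
`stub_fibreSubstitutionTwoCatalystsAE` applies (no algebraicity of `c₁` needed). The bookkeeping is
that of `twoPiece_pieceDescent` (seat c14). [cite: KontsevichZagier2001, §1.2 rule (2)] -/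
theorem twoPiece_pieceAE {d n : ℕ} (p : IntegralRep d) (hκ : p.value ≠ 0)
    (K₁ : Set (Fin d → ℝ)) (hK₁s : IsSemialgebraic ℚ K₁) (hK₁K : K₁ ⊆ p.domain)
    (hv₁ : ∫ x in K₁, p.integrand x ≠ 0)
    (c₁ : ℝ) (hc₁v : c₁ * p.value = ∫ x in K₁, p.integrand x)
    (r r' : IntegralRep n) (q q' : IntegralRep (d + n))
    (hq : q.domain = {z | (fun i => z (Fin.castAdd n i)) ∈ p.domain ∧
      (fun j => z (Fin.natAdd d j)) ∈ r.domain})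
    (hqi : Set.EqOn q.integrand (fun z => p.integrand (fun i => z (Fin.castAdd n i)) *
      r.integrand (fun j => z (Fin.natAdd d j))) q.domain)
    (hq' : q'.domain = {z | (fun i => z (Fin.castAdd n i)) ∈ p.domain ∧
      (fun j => z (Fin.natAdd d j)) ∈ r'.domain})
    (hq'i : Set.EqOn q'.integrand (fun z => p.integrand (fun i => z (Fin.castAdd n i)) *
      r'.integrand (fun j => z (Fin.natAdd d j))) q'.domain)
    (Φ : (Fin (d + n) → ℝ) → (Fin (d + n) → ℝ))
    (Φ' : (Fin (d + n) → ℝ) → (Fin (d + n) → ℝ) →L[ℝ] (Fin (d + n) → ℝ))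
    (hΦ' : ∀ z ∈ q.domain, HasFDerivWithinAt Φ (Φ' z) q.domain z) (hΦinj : Set.InjOn Φ q.domain)
    (himg : q'.domain = Φ '' q.domain)
    (hjac : ∀ z ∈ q.domain, q.integrand z = q'.integrand (Φ z) * |(Φ' z).det|)
    (ψ₁ : (Fin n → ℝ) → (Fin n → ℝ)) (ψ₁' : (Fin n → ℝ) → (Fin n → ℝ) →L[ℝ] (Fin n → ℝ))
    (hfib₁ : ∀ z ∈ q.domain, (fun i => z (Fin.castAdd n i)) ∈ K₁ →
      (fun j => Φ z (Fin.natAdd d j)) = ψ₁ (fun j => z (Fin.natAdd d j)))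
    (hψ₁' : ∀ w ∈ r.domain, HasFDerivWithinAt ψ₁ (ψ₁' w) r.domain w)
    (hψ₁inj : Set.InjOn ψ₁ r.domain)
    (hout : ∀ z ∈ q.domain, (fun i => z (Fin.castAdd n i)) ∉ K₁ →
      (fun j => Φ z (Fin.natAdd d j)) ∉ ψ₁ '' r.domain)
    (r'₁ : IntegralRep n) (hr'₁ : r'₁.domain = ψ₁ '' r.domain)
    (hr'₁i : r'₁.integrand = r'.integrand) :
    ∀ᵐ w ∂(volume.restrict r.domain),
      c₁ * r.integrand w = r'.integrand (ψ₁ w) * |(ψ₁' w).det| := by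
  -- adapted from `twoPiece_pieceDescent` (seat c14): membership in the two pinned products
  have hmemq : ∀ z, z ∈ q.domain ↔ (fun i => z (Fin.castAdd n i)) ∈ p.domain ∧
      (fun j => z (Fin.natAdd d j)) ∈ r.domain := fun z => by rw [hq]; rfl
  have hmemq' : ∀ z, z ∈ q'.domain ↔ (fun i => z (Fin.castAdd n i)) ∈ p.domain ∧
      (fun j => z (Fin.natAdd d j)) ∈ r'.domain := fun z => by rw [hq']; rfl
  -- `ψ₁ σ ⊆ σ'`
  have hsub : ψ₁ '' r.domain ⊆ r'.domain :=
    twoPiece_image_subset hK₁K (twoPiece_nonempty_of_setIntegral_ne_zero hv₁) hq hq' Φ himg ψ₁ hfib₁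
  -- (1) the catalyst piece `p₁ = p|K₁`, of value `κ₁`
  obtain ⟨p₁, hp₁d, hp₁i⟩ : ∃ p₁ : IntegralRep d, p₁.domain = K₁ ∧ p₁.integrand = p.integrand :=
    ⟨p.restrict K₁ hK₁s hK₁K, rfl, rfl⟩
  have hp₁v : p₁.value = ∫ x in K₁, p.integrand x := by
    rw [IntegralRep.value, hp₁d, hp₁i]
  have hp₁ : p₁.value ≠ 0 := by
    rw [hp₁v]
    exact hv₁
  have hc₁v' : c₁ * p.value = p₁.value := by
    rw [hp₁v]
    exact hc₁v
  -- (2) the source piece `q₁ = q|{head ∈ K₁}`, pinned over `r` with catalyst `p₁`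
  have hS : IsSemialgebraic ℚ (q.domain ∩ (fun z : Fin (d + n) → ℝ => z ∘ Fin.castAdd n) ⁻¹' K₁) :=
    q.isSemialgebraic_domain.inter (hK₁s.preimage_comp (Fin.castAdd n))
  obtain ⟨q₁, hq₁d, hq₁i0⟩ : ∃ q₁ : IntegralRep (d + n),
      q₁.domain = q.domain ∩ (fun z : Fin (d + n) → ℝ => z ∘ Fin.castAdd n) ⁻¹' K₁ ∧
      q₁.integrand = q.integrand :=
    ⟨q.restrict _ hS inter_subset_left, rfl, rfl⟩
  have hmemq₁ : ∀ z, z ∈ q₁.domain ↔ z ∈ q.domain ∧ (fun i => z (Fin.castAdd n i)) ∈ K₁ :=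
    fun z => by rw [hq₁d]; rfl
  have hsub₁ : q₁.domain ⊆ q.domain := fun z hz => ((hmemq₁ z).1 hz).1
  have hq₁ : q₁.domain = {z | (fun i => z (Fin.castAdd n i)) ∈ p₁.domain ∧
      (fun j => z (Fin.natAdd d j)) ∈ r.domain} := by
    ext z
    rw [hmemq₁, hmemq, hp₁d, mem_setOf_eq]
    exact ⟨fun h => ⟨h.2, h.1.2⟩, fun h => ⟨⟨hK₁K h.1, h.2⟩, h.1⟩⟩
  have hq₁i : Set.EqOn q₁.integrand (fun z => p₁.integrand (fun i => z (Fin.castAdd n i)) *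
      r.integrand (fun j => z (Fin.natAdd d j))) q₁.domain := by
    intro z hz
    rw [hq₁i0, hp₁i]
    exact hqi (hsub₁ hz)
  -- (3) the target piece `q'₁ = q'|{tail ∈ ψ₁ σ}`, pinned over `r'₁` with catalyst `p`
  have hT : IsSemialgebraic ℚ
      (q'.domain ∩ (fun z : Fin (d + n) → ℝ => z ∘ Fin.natAdd d) ⁻¹' r'₁.domain) :=
    q'.isSemialgebraic_domain.inter (r'₁.isSemialgebraic_domain.preimage_comp (Fin.natAdd d))
  obtain ⟨q'₁, hq'₁d, hq'₁i0⟩ : ∃ q'₁ : IntegralRep (d + n),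
      q'₁.domain = q'.domain ∩ (fun z : Fin (d + n) → ℝ => z ∘ Fin.natAdd d) ⁻¹' r'₁.domain ∧
      q'₁.integrand = q'.integrand :=
    ⟨q'.restrict _ hT inter_subset_left, rfl, rfl⟩
  have hmemq'₁ : ∀ z, z ∈ q'₁.domain ↔
      z ∈ q'.domain ∧ (fun j => z (Fin.natAdd d j)) ∈ r'₁.domain :=
    fun z => by rw [hq'₁d]; rfl
  have hq'₁ : q'₁.domain = {z | (fun i => z (Fin.castAdd n i)) ∈ p.domain ∧
      (fun j => z (Fin.natAdd d j)) ∈ r'₁.domain} := by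
    ext z
    rw [hmemq'₁, hmemq', mem_setOf_eq]
    refine ⟨fun h => ⟨h.1.1, h.2⟩, fun h => ⟨⟨h.1, ?_⟩, h.2⟩⟩
    apply hsub
    rw [← hr'₁]
    exact h.2
  have hq'₁i : Set.EqOn q'₁.integrand (fun z => p.integrand (fun i => z (Fin.castAdd n i)) *
      r'₁.integrand (fun j => z (Fin.natAdd d j))) q'₁.domain := by
    intro z hz
    rw [hq'₁i0, hr'₁i]
    exact hq'i ((hmemq'₁ z).1 hz).1
  -- (4) the one-move data restricted to the piece
  have hΦ'₁ : ∀ z ∈ q₁.domain, HasFDerivWithinAt Φ (Φ' z) q₁.domain z :=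
    fun z hz => (hΦ' z (hsub₁ hz)).mono hsub₁
  have hΦinj₁ : Set.InjOn Φ q₁.domain := hΦinj.mono hsub₁
  have himg₁ : q'₁.domain = Φ '' q₁.domain := by
    apply Subset.antisymm
    · intro z' hz'
      obtain ⟨hz'q, hz't⟩ := (hmemq'₁ z').1 hz'
      rw [himg] at hz'q
      obtain ⟨z, hz, rfl⟩ := hz'q
      refine ⟨z, (hmemq₁ z).2 ⟨hz, ?_⟩, rfl⟩
      by_contra hK
      refine hout z hz hK ?_
      rw [← hr'₁]
      exact hz't
    · rintro _ ⟨z, hz, rfl⟩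
      obtain ⟨hzq, hzK⟩ := (hmemq₁ z).1 hz
      refine (hmemq'₁ _).2 ⟨himg ▸ mem_image_of_mem Φ hzq, ?_⟩
      rw [hr'₁, hfib₁ z hzq hzK]
      exact mem_image_of_mem ψ₁ ((hmemq z).1 hzq).2
  have hjac₁ : ∀ z ∈ q₁.domain, q₁.integrand z = q'₁.integrand (Φ z) * |(Φ' z).det| := by
    intro z hz
    rw [hq₁i0, hq'₁i0]
    exact hjac z (hsub₁ hz)
  have hfib₁' : ∀ z ∈ q₁.domain,
      (fun j => Φ z (Fin.natAdd d j)) = ψ₁ (fun j => z (Fin.natAdd d j)) :=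
    fun z hz => hfib₁ z ((hmemq₁ z).1 hz).1 ((hmemq₁ z).1 hz).2
  -- (5) the measure core of the catalyst exchange `p₁ ⊗ r → p ⊗ r'₁`
  have hae := stub_fibreSubstitutionTwoCatalystsAE p₁ p hp₁ hκ c₁ hc₁v' r r'₁ q₁ q'₁ hq₁ hq₁i hq'₁
    hq'₁i Φ Φ' hΦ'₁ hΦinj₁ himg₁ hjac₁ ψ₁ ψ₁' hfib₁' hψ₁' hψ₁inj
  simpa only [hr'₁i] using hae

/-! ### The stub -/

/-- STUB (seat c15). **Two-piece fibre-form substitutions descend — no hypothesis on the catalyst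
fractions.** Let `p` be a catalyst of non-zero value, split `K = K₁ ⊔ K₂` into two disjoint
`ℚ`-semialgebraic pieces of non-zero mass, and let ONE change of variables `Φ : p ⊗ r → p ⊗ r'` be of
fibre form `ψᵢ` on each piece `Kᵢ × σ` (`ψᵢ` `ℚ`-semialgebraic, injective on `σ = r.domain`,
differentiable within `σ`) with DISJOINT images `ψ₁ σ`, `ψ₂ σ`. Then `r ∼ r'`. Compared with seat c14's
`stub_twoPieceFibreSubstitution` the mass fractions `cᵢ = (∫_{Kᵢ} k)/(∫_K k)` are NO LONGER ASSUMED
ALGEBRAIC: if the base `r` is not null they ARE algebraic (`isAlgebraic_of_ae_scaledJacobian` applied to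
the piece identities `cᵢ · f = (f' ∘ ψᵢ)|det ψᵢ'|`, `twoPiece_pieceAE`) and c14's theorem applies; if `r`
is null, so is `r'` (the piece identities give `|det ψᵢ'| = 0` a.e. where `f' ∘ ψᵢ ≠ 0`, so
`{f' ≠ 0} ⊆ ψ₁ A₁ ∪ ψ₂ A₂` is null by the area inequality), and both are relations. In particular the
"transcendental fraction" version of this certificate shape (a disc segment, an incomplete Beta value;
crux notes c14 K5 (iv)/K7) does not exist. [cite: KontsevichZagier2001, §1.2 rules (1), (2)] -/
theorem stub_twoPieceFibreSubstitution_anyFractions {d n : ℕ} (p : IntegralRep d) (hκ : p.value ≠ 0)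
    (K₁ K₂ : Set (Fin d → ℝ))
    (hK₁s : Literature.ModelTheory.ExponentialFields.IsSemialgebraic ℚ K₁)
    (hK₂s : Literature.ModelTheory.ExponentialFields.IsSemialgebraic ℚ K₂)
    (hKu : K₁ ∪ K₂ = p.domain) (hKd : Disjoint K₁ K₂)
    (hv₁ : ∫ x in K₁, p.integrand x ≠ 0) (hv₂ : ∫ x in K₂, p.integrand x ≠ 0)
    (r r' : IntegralRep n) (q q' : IntegralRep (d + n))
    (hq : q.domain = {z | (fun i => z (Fin.castAdd n i)) ∈ p.domain ∧
      (fun j => z (Fin.natAdd d j)) ∈ r.domain})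
    (hqi : Set.EqOn q.integrand (fun z => p.integrand (fun i => z (Fin.castAdd n i)) *
      r.integrand (fun j => z (Fin.natAdd d j))) q.domain)
    (hq' : q'.domain = {z | (fun i => z (Fin.castAdd n i)) ∈ p.domain ∧
      (fun j => z (Fin.natAdd d j)) ∈ r'.domain})
    (hq'i : Set.EqOn q'.integrand (fun z => p.integrand (fun i => z (Fin.castAdd n i)) *
      r'.integrand (fun j => z (Fin.natAdd d j))) q'.domain)
    (Φ : (Fin (d + n) → ℝ) → (Fin (d + n) → ℝ))
    (Φ' : (Fin (d + n) → ℝ) → (Fin (d + n) → ℝ) →L[ℝ] (Fin (d + n) → ℝ))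
    (hΦ' : ∀ z ∈ q.domain, HasFDerivWithinAt Φ (Φ' z) q.domain z) (hΦinj : Set.InjOn Φ q.domain)
    (himg : q'.domain = Φ '' q.domain)
    (hjac : ∀ z ∈ q.domain, q.integrand z = q'.integrand (Φ z) * |(Φ' z).det|)
    (ψ₁ ψ₂ : (Fin n → ℝ) → (Fin n → ℝ)) (ψ₁' ψ₂' : (Fin n → ℝ) → (Fin n → ℝ) →L[ℝ] (Fin n → ℝ))
    (hψ₁sa : IsSemialgebraicMapOn ℚ r.domain ψ₁) (hψ₂sa : IsSemialgebraicMapOn ℚ r.domain ψ₂)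
    (hfib₁ : ∀ z ∈ q.domain, (fun i => z (Fin.castAdd n i)) ∈ K₁ →
      (fun j => Φ z (Fin.natAdd d j)) = ψ₁ (fun j => z (Fin.natAdd d j)))
    (hfib₂ : ∀ z ∈ q.domain, (fun i => z (Fin.castAdd n i)) ∈ K₂ →
      (fun j => Φ z (Fin.natAdd d j)) = ψ₂ (fun j => z (Fin.natAdd d j)))
    (hψ₁' : ∀ w ∈ r.domain, HasFDerivWithinAt ψ₁ (ψ₁' w) r.domain w)
    (hψ₂' : ∀ w ∈ r.domain, HasFDerivWithinAt ψ₂ (ψ₂' w) r.domain w)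
    (hψ₁inj : Set.InjOn ψ₁ r.domain) (hψ₂inj : Set.InjOn ψ₂ r.domain)
    (hdisj : Disjoint (ψ₁ '' r.domain) (ψ₂ '' r.domain)) :
    Equivalent r r' := by
  -- (0) the catalyst fractions `cᵢ = κᵢ / p.value`
  set c₁ : ℝ := (∫ x in K₁, p.integrand x) / p.value with hc₁_def
  set c₂ : ℝ := (∫ x in K₂, p.integrand x) / p.value with hc₂_def
  have hc₁v : c₁ * p.value = ∫ x in K₁, p.integrand x := div_mul_cancel₀ _ hκ
  have hc₂v : c₂ * p.value = ∫ x in K₂, p.integrand x := div_mul_cancel₀ _ hκ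
  -- common bookkeeping (as in `stub_twoPieceFibreSubstitution`, seat c14)
  have hK₁K : K₁ ⊆ p.domain := by
    rw [← hKu]
    exact subset_union_left
  have hK₂K : K₂ ⊆ p.domain := by
    rw [← hKu]
    exact subset_union_right
  have hK₁ne : K₁.Nonempty := twoPiece_nonempty_of_setIntegral_ne_zero hv₁
  have hK₂ne : K₂.Nonempty := twoPiece_nonempty_of_setIntegral_ne_zero hv₂
  have hsub₁ : ψ₁ '' r.domain ⊆ r'.domain :=
    twoPiece_image_subset hK₁K hK₁ne hq hq' Φ himg ψ₁ hfib₁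
  have hsub₂ : ψ₂ '' r.domain ⊆ r'.domain :=
    twoPiece_image_subset hK₂K hK₂ne hq hq' Φ himg ψ₂ hfib₂
  have himg₁s : IsSemialgebraic ℚ (ψ₁ '' r.domain) :=
    IsSemialgebraicMapOn.isSemialgebraic_image_holds hψ₁sa Subset.rfl r.isSemialgebraic_domain
  have himg₂s : IsSemialgebraic ℚ (ψ₂ '' r.domain) :=
    IsSemialgebraicMapOn.isSemialgebraic_image_holds hψ₂sa Subset.rfl r.isSemialgebraic_domain
  obtain ⟨r'₁, hr'₁, hr'₁i⟩ : ∃ r'₁ : IntegralRep n,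
      r'₁.domain = ψ₁ '' r.domain ∧ r'₁.integrand = r'.integrand :=
    ⟨r'.restrict _ himg₁s hsub₁, rfl, rfl⟩
  obtain ⟨r'₂, hr'₂, hr'₂i⟩ : ∃ r'₂ : IntegralRep n,
      r'₂.domain = ψ₂ '' r.domain ∧ r'₂.integrand = r'.integrand :=
    ⟨r'.restrict _ himg₂s hsub₂, rfl, rfl⟩
  have hmemq : ∀ z, z ∈ q.domain ↔ (fun i => z (Fin.castAdd n i)) ∈ p.domain ∧
      (fun j => z (Fin.natAdd d j)) ∈ r.domain := fun z => by rw [hq]; rfl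
  have hhead : ∀ z ∈ q.domain, (fun i => z (Fin.castAdd n i)) ∈ K₁ ∪ K₂ := fun z hz => by
    rw [hKu]
    exact ((hmemq z).1 hz).1
  have hout₁ : ∀ z ∈ q.domain, (fun i => z (Fin.castAdd n i)) ∉ K₁ →
      (fun j => Φ z (Fin.natAdd d j)) ∉ ψ₁ '' r.domain := by
    intro z hz hK h₁
    have h₂ : (fun j => Φ z (Fin.natAdd d j)) ∈ ψ₂ '' r.domain := by
      rw [hfib₂ z hz ((hhead z hz).resolve_left hK)]
      exact mem_image_of_mem ψ₂ ((hmemq z).1 hz).2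
    exact Set.disjoint_left.1 hdisj h₁ h₂
  have hout₂ : ∀ z ∈ q.domain, (fun i => z (Fin.castAdd n i)) ∉ K₂ →
      (fun j => Φ z (Fin.natAdd d j)) ∉ ψ₂ '' r.domain := by
    intro z hz hK h₂
    have h₁ : (fun j => Φ z (Fin.natAdd d j)) ∈ ψ₁ '' r.domain := by
      rw [hfib₁ z hz ((hhead z hz).resolve_right hK)]
      exact mem_image_of_mem ψ₁ ((hmemq z).1 hz).2
    exact Set.disjoint_left.1 hdisj h₁ h₂
  -- (1) the two piece identities `cᵢ · f = (f' ∘ ψᵢ)|det ψᵢ'|` a.e. on `σ`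
  have hae₁ := twoPiece_pieceAE p hκ K₁ hK₁s hK₁K hv₁ c₁ hc₁v r r' q q' hq hqi hq' hq'i Φ Φ' hΦ' hΦinj
    himg hjac ψ₁ ψ₁' hfib₁ hψ₁' hψ₁inj hout₁ r'₁ hr'₁ hr'₁i
  have hae₂ := twoPiece_pieceAE p hκ K₂ hK₂s hK₂K hv₂ c₂ hc₂v r r' q q' hq hqi hq' hq'i Φ Φ' hΦ' hΦinj
    himg hjac ψ₂ ψ₂' hfib₂ hψ₂' hψ₂inj hout₂ r'₂ hr'₂ hr'₂i
  have hσm : MeasurableSet r.domain := IntegralRep.measurableSet_domain_holds r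
  by_cases hr : volume {w | w ∈ r.domain ∧ r.integrand w ≠ 0} = 0
  · -- (2) degenerate case: `r` is null, hence so is `r'`, and both are relations
    have hf0 : ∀ᵐ w ∂(volume.restrict r.domain), r.integrand w = 0 := by
      rw [ae_restrict_iff' hσm, ae_iff]
      convert hr using 2
      ext w
      simp only [mem_setOf_eq, Classical.not_imp]
    have h₁ : of r ∈ relations := of_mem_relations_of_volume_sep_ne_zero_eq_zero r hr
    have h₂ : of r' ∈ relations := by
      apply of_mem_relations_of_volume_sep_ne_zero_eq_zero r'
      have hcover : {w' | w' ∈ r'.domain ∧ r'.integrand w' ≠ 0} ⊆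
          ψ₁ '' {w | w ∈ r.domain ∧ r'.integrand (ψ₁ w) ≠ 0} ∪
            ψ₂ '' {w | w ∈ r.domain ∧ r'.integrand (ψ₂ w) ≠ 0} := by
        intro w' hw'
        have hw'u : w' ∈ ψ₁ '' r.domain ∪ ψ₂ '' r.domain :=
          twoPiece_subset_union_image hKu (hK₁ne.mono hK₁K) hq hq' Φ himg ψ₁ ψ₂ hfib₁ hfib₂ hw'.1
        rcases hw'u with ⟨w, hw, rfl⟩ | ⟨w, hw, rfl⟩
        · exact Or.inl ⟨w, ⟨hw, hw'.2⟩, rfl⟩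
        · exact Or.inr ⟨w, ⟨hw, hw'.2⟩, rfl⟩
      have hz : ∀ (ψ : (Fin n → ℝ) → (Fin n → ℝ)) (ψ' : (Fin n → ℝ) → (Fin n → ℝ) →L[ℝ] (Fin n → ℝ))
          (c : ℝ), (∀ᵐ w ∂(volume.restrict r.domain),
            c * r.integrand w = r'.integrand (ψ w) * |(ψ' w).det|) →
          ∀ᵐ w ∂(volume.restrict r.domain), r'.integrand (ψ w) * |(ψ' w).det| = 0 := by
        intro ψ ψ' c hae
        filter_upwards [hae, hf0] with w hw hw0
        rw [← hw, hw0, mul_zero]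
      exact measure_mono_null hcover (measure_union_null
        (volume_image_sep_ne_zero_eq_zero r r' ψ₁ ψ₁' hψ₁sa
          (fun w hw => hsub₁ (mem_image_of_mem ψ₁ hw)) hψ₁' (hz ψ₁ ψ₁' c₁ hae₁))
        (volume_image_sep_ne_zero_eq_zero r r' ψ₂ ψ₂' hψ₂sa
          (fun w hw => hsub₂ (mem_image_of_mem ψ₂ hw)) hψ₂' (hz ψ₂ ψ₂' c₂ hae₂)))
    exact relations.sub_mem h₁ h₂
  · -- (3) non-degenerate case: the fractions are algebraic, and seat c14's theorem applies
    have hc₁ : IsAlgebraic ℚ c₁ :=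
      isAlgebraic_of_ae_scaledJacobian r r' c₁ ψ₁ ψ₁' hψ₁sa (fun w hw => hsub₁ (mem_image_of_mem ψ₁ hw)) hψ₁' hae₁ hr
    have hc₂ : IsAlgebraic ℚ c₂ :=
      isAlgebraic_of_ae_scaledJacobian r r' c₂ ψ₂ ψ₂' hψ₂sa (fun w hw => hsub₂ (mem_image_of_mem ψ₂ hw)) hψ₂' hae₂ hr
    exact stub_twoPieceFibreSubstitution p K₁ K₂ hK₁s hK₂s hKu hKd hv₁ hv₂ c₁ c₂ hc₁ hc₂ hc₁v hc₂v
      r r' q q' hq hqi hq' hq'i Φ Φ' hΦ' hΦinj himg hjac ψ₁ ψ₂ ψ₁' ψ₂' hψ₁sa hψ₂sa hfib₁ hfib₂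
      hψ₁' hψ₂' hψ₁inj hψ₂inj hdisj

end Summit.KontsevichZagierPeriods.KontsevichZagierPeriods.BetaCancellationLine

end
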